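import Summits.NavierStokesRegularity.FluidComputer.OptimalSobolevClock
import Summits.NavierStokesRegularity.FluidComputer.SobolevLadderSerrin
import Summits.NavierStokesRegularity.FluidComputer.SobolevLadderProduct
import HarnessLib

/-!
# Fluid computer — the Sobolev ladder on its WHOLE optimal range in one statement (`1 < κ < 5`,
# `1/2 < s < 5/2`), with L58's forms: time-integrated, scale-free product, interface reading

HONEST FRAMING (cell `pub-fluidc`, verbatim): *low prior, high value-of-information experiment on Tao's
machine paradigm; NOT a claim that NS blows up.* Theorem side of the cell (the level dictionary); nothing here is
evidence of blow-up — necessities for EVERY maximal smooth finite-energy solution on `ℝ³`.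

The rate-optimal rows were landed in three pieces: L52 (`HomSobolevLadder`, `HomSobolev32Clock.dyadic_clock_of_homSobolev`;
`1/2 < s < 3/2`), L56/L57 (`Besov32Clock`, `HomSobolev32Clock`; `s = 3/2`) and L58 (`OptimalSobolevClock`; `3/2 < s < 5/2`).
This file states them ONCE over the whole range and derives L58's companion forms (as `Besov32Forms` did for L56):

* `row_clock` — for every `κ ∈ (1, 5)` one `c_κ > 0` with `c_κ ν^{(5−κ)/2} (T − t)^{−(κ−1)/2} ≤ ∑_j 2^{κj} ‖Δ̇_j u(t)‖₂²`
  at EVERY `t ∈ (0, T)`; `homSobolev_clock` — for every `s ∈ (1/2, 5/2)`: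
  `c_s ν^{(5−2s)/4} (T − t)^{−(2s−1)/4} ≤ ‖u(t)‖_{Ḣ^s}` (Robinson–Sadowski–Silva's optimal rate on its full range);
* `row_tendsto_top`, `homSobolev_tendsto_top` — the rows / norms tend to `∞` as `t ↑ T`;
* `row_log_floor`, `row_lintegral_eq_top`, `homSobolev_log_floor`, `homSobolev_lintegral_eq_top` (**L58-S**) — the rows
  raised to the scaling exponent (`2/(κ−1)`, resp. `4/(2s−1)`) have logarithmic running-integral floors and infinite
  integral over every terminal window: `u ∉ L^{4/(2s−1)}(t₀, T; Ḣ^s)` for EVERY `s ∈ (1/2, 5/2)` — the Sobolev–Serrin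
  scale `2/q + 3/r = 1`, `r = 6/(3−2s)` formally, continued past `r = ∞` up to `q > 1`;
* `homSobolev_energy_product` (**L58-P**) — `c_s ν^{2s} ≤ ‖u(t)‖₂^{2s−1} ‖u(t)‖_{Ḣ^s}` at every `t`, every `s ∈ (1/2, 5/2)`;
* `homSobolev_clock_of_cascadeWitness` — the interface reading for the whole range.

0 sorry; no definitions; no named facts (inputs: the three clocks, `SobolevLadderSerrin.log_le_lintegral_rpow_of_clock` /
`lintegral_rpow_eq_top_of_clock`, `SobolevLadderProduct.product_of_clock_and_deadline`, `LerayDeadline.deadline`).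
HONEST: constants inexplicit and `s`-dependent (three different mechanisms glued: Leray's `L^r` rates + embedding below
`3/2`, Cheskidov–Zaya's Riccati law at and above `3/2`); nothing at `s = 5/2` or above (there see `HomSobolevSuperLadder`).

## References

* J. C. Robinson, W. Sadowski, R. P. Silva, J. Math. Phys. 53 (2012) 115618, abstract / (1.2) and §IV.
  [RobinsonSadowskiSilva2012]
* A. Cheskidov, K. Zaya, J. Math. Phys. 57 (2016) 023101 = arXiv:1503.01784, Remark 2.3, Thm. 2.4. [CheskidovZaya2016]
* G. Prodi, Ann. Mat. Pura Appl. 48 (1959) 173–182. [Prodi1959]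
* J. Leray, Acta Math. 63 (1934), §34 (6.4) p. 246. [Leray1934]
-/

noncomputable section

open MeasureTheory Set Function Filter Topology
open scoped ENNReal NNReal
open Literature.Analysis.FluidPDE Literature.Analysis.FunctionSpaces
open Literature.Analysis.FluidPDE.FluidComputer
open Summit.NavierStokesRegularity.NavierStokesRegularity.Theorems.FluidComputer (x5a_of_cascadeWitness')
open Summit.NavierStokesRegularity.FluidComputer.OptimalSobolevClock
open Summit.NavierStokesRegularity.FluidComputer.SobolevLadderSerrin
open Summit.NavierStokesRegularity.FluidComputer.SobolevLadderProduct
open Summit.NavierStokesRegularity.FluidComputer.SobolevLadderFront (tendsto_ofReal_clock_top)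

namespace Summit.NavierStokesRegularity.FluidComputer.SobolevLadderRange

/-! ## The clocks on the whole range -/

/-- **THE OPTIMAL DYADIC ROWS, `1 < κ < 5`, in one statement.** For every `κ ∈ (1, 5)` there is `c = c_κ > 0` such
that for every `ν > 0`, `T > 0`, every maximal smooth solution `(u, p)` of the unforced Navier–Stokes system on
`ℝ³ × [0, T)` which is Leray–Hopf from `u 0`, and EVERY `t ∈ (0, T)`:
`c · ν^{(5−κ)/2} · (T − t)^{−(κ−1)/2} ≤ ∑_{j∈ℤ} 2^{κj} ‖Δ̇_j u(t)‖₂²` — L52 in ℓ² (`dyadic_clock_of_homSobolev`,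
`κ < 3`), L56 (`besov32_clock_rpow`, `κ = 3`), L58 (`row_clock_gen`, `κ > 3`). [cite: RobinsonSadowskiSilva2012, (1.2), §IV]
[cite: CheskidovZaya2016, Remark 2.3, Thm. 2.4] -/
theorem row_clock {κ : ℝ} (hκ : κ ∈ Ioo (1 : ℝ) 5) :
    ∃ c : ℝ, 0 < c ∧ ∀ (ν T : ℝ), 0 < ν → 0 < T →
      ∀ (u : ℝ → EuclideanSpace ℝ (Fin 3) → EuclideanSpace ℝ (Fin 3)) (p : ℝ → EuclideanSpace ℝ (Fin 3) → ℝ),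
      IsMaximalSmoothSolution ν 0 u p T → IsLerayHopfOn T ν 0 (u 0) u →
      ∀ t ∈ Ioo 0 T,
        ENNReal.ofReal (c * ν ^ ((5 - κ) / 2) * (T - t) ^ (-((κ - 1) / 2))) ≤
          ∑' j : ℤ, (2 : ℝ≥0∞) ^ (κ * (j : ℝ)) * blockL2 (u t) j ^ 2 := by
  rcases lt_trichotomy κ 3 with hlt | heq | hgt
  · -- `κ < 3`: L52 squared, `s = κ/2 ∈ (1/2, 3/2)`
    obtain ⟨c, hc, H⟩ := HomSobolev32Clock.dyadic_clock_of_homSobolev (κ / 2)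
      ⟨by linarith [hκ.1], by linarith⟩
    refine ⟨c, hc, fun ν T hν hT u p hmax hLH t ht => ?_⟩
    have h := H ν T hν hT u p hmax hLH t ht
    have e1 : (5 - 2 * (κ / 2)) / 2 = (5 - κ) / 2 := by ring
    have e2 : (2 * (κ / 2) - 1) / 2 = (κ - 1) / 2 := by ring
    have e3 : 2 * (κ / 2) = κ := by ring
    rw [e1, e2] at h
    simpa only [e3] using h
  · -- `κ = 3`: L56
    subst heq
    obtain ⟨c, hc, H⟩ := Besov32Clock.besov32_clock_rpow
    refine ⟨c, hc, fun ν T hν hT u p hmax hLH t ht => ?_⟩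
    have h := H ν T hν hT u p hmax hLH t ht
    norm_num at h ⊢
    exact h
  · -- `κ > 3`: L58
    exact row_clock_gen hgt hκ.2

/-- **THE SOBOLEV LADDER ON ITS WHOLE OPTIMAL RANGE `1/2 < s < 5/2`, in one statement.** For every
`s ∈ (1/2, 5/2)` there is `c = c_s > 0` such that for every `ν > 0`, `T > 0`, every maximal smooth solution `(u, p)`
of the unforced Navier–Stokes system on `ℝ³ × [0, T)` which is Leray–Hopf from `u 0`, and EVERY `t ∈ (0, T)`:
`c · ν^{(5−2s)/4} · (T − t)^{−(2s−1)/4} ≤ ‖u(t)‖_{Ḣ^s}` (the tree's Fourier-side seminorm of the complexified slice)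
— Robinson–Sadowski–Silva's scaling-sharp rate on their whole range INCLUDING the midpoint `s = 3/2` the print
excludes (L52 `HomSobolevLadder.homSobolev_clock`, L57 `homSobolev32_clock`, L58 `homSobolev_clock_gen`). Necessity
only; constants inexplicit. [cite: RobinsonSadowskiSilva2012, (1.2), §IV] [cite: CheskidovZaya2016, Thm. 2.4, Remark 2.3] -/
theorem homSobolev_clock (s : ℝ) (hs : s ∈ Ioo (1 / 2 : ℝ) (5 / 2)) :
    ∃ c : ℝ, 0 < c ∧ ∀ (ν T : ℝ), 0 < ν → 0 < T →
      ∀ (u : ℝ → EuclideanSpace ℝ (Fin 3) → EuclideanSpace ℝ (Fin 3)) (p : ℝ → EuclideanSpace ℝ (Fin 3) → ℝ),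
      IsMaximalSmoothSolution ν 0 u p T → IsLerayHopfOn T ν 0 (u 0) u →
      ∀ t ∈ Ioo 0 T,
        ENNReal.ofReal (c * ν ^ ((5 - 2 * s) / 4) * (T - t) ^ (-((2 * s - 1) / 4))) ≤
          Function.eHomSobolevSeminorm s (⇑EuclideanSpace.complexify ∘ u t) := by
  rcases lt_trichotomy s (3 / 2) with hlt | heq | hgt
  · exact HomSobolevLadder.homSobolev_clock s ⟨hs.1, hlt⟩
  · subst heq
    obtain ⟨c, hc, H⟩ := HomSobolev32Clock.homSobolev32_clock
    refine ⟨c, hc, fun ν T hν hT u p hmax hLH t ht => ?_⟩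
    have h := H ν T hν hT u p hmax hLH t ht
    norm_num at h ⊢
    exact h
  · exact homSobolev_clock_gen s ⟨hgt, hs.2⟩

/-! ## Divergence at the lifespan -/

/-- **Every optimal row diverges at the lifespan**, `1 < κ < 5`: `∑_j 2^{κj} ‖Δ̇_j u(t)‖₂² → ∞` as `t ↑ T` along every
maximal smooth Leray–Hopf solution of the unforced system (`ν > 0`), at the rate of `row_clock`.
[cite: RobinsonSadowskiSilva2012, (1.2), §IV] -/
theorem row_tendsto_top {κ : ℝ} (hκ : κ ∈ Ioo (1 : ℝ) 5) {ν T : ℝ} (hν : 0 < ν) (hT : 0 < T)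
    {u : ℝ → EuclideanSpace ℝ (Fin 3) → EuclideanSpace ℝ (Fin 3)} {p : ℝ → EuclideanSpace ℝ (Fin 3) → ℝ}
    (hmax : IsMaximalSmoothSolution ν 0 u p T) (hLH : IsLerayHopfOn T ν 0 (u 0) u) :
    Tendsto (fun t => ∑' j : ℤ, (2 : ℝ≥0∞) ^ (κ * (j : ℝ)) * blockL2 (u t) j ^ 2) (𝓝[<] T) (𝓝 ∞) := by
  obtain ⟨c, hc, H⟩ := row_clock hκ
  refine tendsto_nhds_top_mono (tendsto_ofReal_clock_top (a := (5 - κ) / 2) (T := T) hc hν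
    (by linarith [hκ.1] : (0 : ℝ) < (κ - 1) / 2)) ?_
  filter_upwards [Ioo_mem_nhdsLT hT] with t ht
  exact H ν T hν hT u p hmax hLH t ht

/-- **`‖u(t)‖_{Ḣ^s} → ∞` as `t ↑ T` for every `s ∈ (1/2, 5/2)`**, at the optimal rate of `homSobolev_clock`, along every
maximal smooth Leray–Hopf solution of the unforced system (`ν > 0`). (For `s ≥ 5/2` see
`HomSobolevSuperLadder.homSobolev_superLadder_tendsto_top`; at `s = 1/2`, `CriticalFace`.)
[cite: RobinsonSadowskiSilva2012, (1.2), §IV] -/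
theorem homSobolev_tendsto_top (s : ℝ) (hs : s ∈ Ioo (1 / 2 : ℝ) (5 / 2)) {ν T : ℝ} (hν : 0 < ν) (hT : 0 < T)
    {u : ℝ → EuclideanSpace ℝ (Fin 3) → EuclideanSpace ℝ (Fin 3)} {p : ℝ → EuclideanSpace ℝ (Fin 3) → ℝ}
    (hmax : IsMaximalSmoothSolution ν 0 u p T) (hLH : IsLerayHopfOn T ν 0 (u 0) u) :
    Tendsto (fun t => Function.eHomSobolevSeminorm s (⇑EuclideanSpace.complexify ∘ u t)) (𝓝[<] T) (𝓝 ∞) := by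
  obtain ⟨c, hc, H⟩ := homSobolev_clock s hs
  refine tendsto_nhds_top_mono (tendsto_ofReal_clock_top (a := (5 - 2 * s) / 4) (T := T) hc hν
    (by linarith [hs.1] : (0 : ℝ) < (2 * s - 1) / 4)) ?_
  filter_upwards [Ioo_mem_nhdsLT hT] with t ht
  exact H ν T hν hT u p hmax hLH t ht

/-! ## L58-S: the rows time-integrated (the Sobolev–Serrin scale up to `s < 5/2`) -/

/-- Exponent bookkeeping for the dyadic rows: with `a = (5 − κ)/2`, `b = (κ − 1)/2` (`κ > 1`), `1/b = 2/(κ − 1)` and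
`(c ν^a)^{1/b} = c^{2/(κ−1)} ν^{(5−κ)/(κ−1)}`. [folklore] -/
theorem row_exponents {c ν κ : ℝ} (hc : 0 < c) (hν : 0 < ν) (hκ : 1 < κ) :
    1 / ((κ - 1) / 2) = 2 / (κ - 1) ∧
      (c * ν ^ ((5 - κ) / 2)) ^ (2 / (κ - 1)) = c ^ (2 / (κ - 1)) * ν ^ ((5 - κ) / (κ - 1)) := by
  have hb : 0 < κ - 1 := by linarith
  have e : 1 / ((κ - 1) / 2) = 2 / (κ - 1) := by field_simp
  refine ⟨e, ?_⟩
  rw [Real.mul_rpow hc.le (Real.rpow_nonneg hν.le _), ← Real.rpow_mul hν.le]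
  congr 2
  field_simp

/-- **L58-S — LOGARITHMIC FLOOR OF THE RUNNING INTEGRALS OF THE ROWS**, `1 < κ < 5`. For every `κ ∈ (1, 5)` there is
`c > 0` such that along every maximal smooth solution `(u, p)` of the unforced Navier–Stokes system on `ℝ³ × [0, T)`
(`ν > 0`) which is Leray–Hopf from `u 0`, for all `0 ≤ t₀ ≤ t < T`:
`c · ν^{(5−κ)/(κ−1)} · log((T − t₀)/(T − t)) ≤ ∫⁻_{(t₀,t)} (∑_j 2^{κj} ‖Δ̇_j u(τ)‖₂²)^{2/(κ−1)} dτ`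
(`row_clock` raised to the scaling exponent `2/(κ−1)`, the one making the right side `∝ (T − τ)^{−1}`). At `κ = 3` this
is L56-S (`∫ Y`), at `κ = 2` it is `∫ F²` (L30‴ in dyadic currency). [cite: Prodi1959]
[cite: RobinsonSadowskiSilva2012, (1.2), §IV] -/
theorem row_log_floor {κ : ℝ} (hκ : κ ∈ Ioo (1 : ℝ) 5) :
    ∃ c : ℝ, 0 < c ∧ ∀ (ν T : ℝ), 0 < ν → 0 < T →
      ∀ (u : ℝ → EuclideanSpace ℝ (Fin 3) → EuclideanSpace ℝ (Fin 3)) (p : ℝ → EuclideanSpace ℝ (Fin 3) → ℝ),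
      IsMaximalSmoothSolution ν 0 u p T → IsLerayHopfOn T ν 0 (u 0) u →
      ∀ t₀ t : ℝ, 0 ≤ t₀ → t₀ ≤ t → t < T →
        ENNReal.ofReal (c * ν ^ ((5 - κ) / (κ - 1)) * Real.log ((T - t₀) / (T - t))) ≤
          ∫⁻ τ in Ioo t₀ t, (∑' j : ℤ, (2 : ℝ≥0∞) ^ (κ * (j : ℝ)) * blockL2 (u τ) j ^ 2) ^ (2 / (κ - 1)) := by
  obtain ⟨c, hc, H⟩ := row_clock hκ
  have hb : 0 < (κ - 1) / 2 := by linarith [hκ.1]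
  refine ⟨c ^ (2 / (κ - 1)), by positivity, fun ν T hν hT u p hmax hLH t₀ t ht₀ h₀ ht => ?_⟩
  obtain ⟨e1, e2⟩ := row_exponents (c := c) (ν := ν) hc hν hκ.1
  have h := log_le_lintegral_rpow_of_clock (a := (5 - κ) / 2) (T := T) hc hν hb h₀ ht
    (X := fun τ => ∑' j : ℤ, (2 : ℝ≥0∞) ^ (κ * (j : ℝ)) * blockL2 (u τ) j ^ 2)
    (fun τ hτ => H ν T hν hT u p hmax hLH τ ⟨ht₀.trans_lt hτ.1, hτ.2.trans ht⟩)
  rw [e1, e2, mul_assoc] at h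
  rw [mul_assoc]
  exact h

/-- **L58-S — THE SCALING-EXPONENT INTEGRAL OF EVERY OPTIMAL ROW OVER A TERMINAL WINDOW DIVERGES**, `1 < κ < 5`:
along every maximal smooth Leray–Hopf solution of the unforced system (`ν > 0`), for every `t₀ ∈ [0, T)`:
`∫⁻_{(t₀,T)} (∑_j 2^{κj} ‖Δ̇_j u(τ)‖₂²)^{2/(κ−1)} dτ = ∞` — `u ∉ L^{4/(κ−1)}(t₀, T; Ḃ^{κ/2}_{2,2})`.
[cite: Prodi1959] [cite: RobinsonSadowskiSilva2012, (1.2), §IV] -/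
theorem row_lintegral_eq_top {κ : ℝ} (hκ : κ ∈ Ioo (1 : ℝ) 5) {ν T : ℝ} (hν : 0 < ν) (hT : 0 < T)
    {u : ℝ → EuclideanSpace ℝ (Fin 3) → EuclideanSpace ℝ (Fin 3)} {p : ℝ → EuclideanSpace ℝ (Fin 3) → ℝ}
    (hmax : IsMaximalSmoothSolution ν 0 u p T) (hLH : IsLerayHopfOn T ν 0 (u 0) u)
    {t₀ : ℝ} (ht₀ : t₀ ∈ Ico 0 T) :
    ∫⁻ τ in Ioo t₀ T, (∑' j : ℤ, (2 : ℝ≥0∞) ^ (κ * (j : ℝ)) * blockL2 (u τ) j ^ 2) ^ (2 / (κ - 1)) = ∞ := by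
  obtain ⟨c, hc, H⟩ := row_clock hκ
  have hb : 0 < (κ - 1) / 2 := by linarith [hκ.1]
  have e1 : 1 / ((κ - 1) / 2) = 2 / (κ - 1) := by field_simp
  have h := lintegral_rpow_eq_top_of_clock (a := (5 - κ) / 2) hc hν hb ht₀.2
    (X := fun τ => ∑' j : ℤ, (2 : ℝ≥0∞) ^ (κ * (j : ℝ)) * blockL2 (u τ) j ^ 2)
    (fun τ hτ => H ν T hν hT u p hmax hLH τ ⟨ht₀.1.trans_lt hτ.1, hτ.2⟩)
  rw [e1] at h
  exact h

/-- **L58-S — LOGARITHMIC FLOOR OF THE RUNNING `L^{4/(2s−1)}_t Ḣ^s_x` INTEGRAL, every `s ∈ (1/2, 5/2)`.** For every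
such `s` there is `c > 0` such that along every maximal smooth Leray–Hopf solution of the unforced system (`ν > 0`),
for all `0 ≤ t₀ ≤ t < T`: `c · ν^{(5−2s)/(2s−1)} · log((T − t₀)/(T − t)) ≤ ∫⁻_{(t₀,t)} ‖u(τ)‖_{Ḣ^s}^{4/(2s−1)} dτ`
(extends L52-S `SobolevLadderSerrin.homSobolev_log_floor`, `s < 3/2`, to the whole optimal range).
[cite: Prodi1959] [cite: RobinsonSadowskiSilva2012, (1.2), §IV] -/
theorem homSobolev_log_floor (s : ℝ) (hs : s ∈ Ioo (1 / 2 : ℝ) (5 / 2)) :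
    ∃ c : ℝ, 0 < c ∧ ∀ (ν T : ℝ), 0 < ν → 0 < T →
      ∀ (u : ℝ → EuclideanSpace ℝ (Fin 3) → EuclideanSpace ℝ (Fin 3)) (p : ℝ → EuclideanSpace ℝ (Fin 3) → ℝ),
      IsMaximalSmoothSolution ν 0 u p T → IsLerayHopfOn T ν 0 (u 0) u →
      ∀ t₀ t : ℝ, 0 ≤ t₀ → t₀ ≤ t → t < T →
        ENNReal.ofReal (c * ν ^ ((5 - 2 * s) / (2 * s - 1)) * Real.log ((T - t₀) / (T - t))) ≤
          ∫⁻ τ in Ioo t₀ t,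
            Function.eHomSobolevSeminorm s (⇑EuclideanSpace.complexify ∘ u τ) ^ (4 / (2 * s - 1)) := by
  obtain ⟨c, hc, H⟩ := homSobolev_clock s hs
  have hb : 0 < (2 * s - 1) / 4 := by linarith [hs.1]
  refine ⟨c ^ (4 / (2 * s - 1)), by positivity, fun ν T hν hT u p hmax hLH t₀ t ht₀ h₀ ht => ?_⟩
  obtain ⟨e1, e2⟩ := ladder_exponents (c := c) (ν := ν) hc hν hs.1
  have h := log_le_lintegral_rpow_of_clock (a := (5 - 2 * s) / 4) (T := T) hc hν hb h₀ ht
    (X := fun τ => Function.eHomSobolevSeminorm s (⇑EuclideanSpace.complexify ∘ u τ))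
    (fun τ hτ => H ν T hν hT u p hmax hLH τ ⟨ht₀.trans_lt hτ.1, hτ.2.trans ht⟩)
  rw [e1, e2, mul_assoc] at h
  rw [mul_assoc]
  exact h

/-- **L58-S — `u ∉ L^{4/(2s−1)}(t₀, T; Ḣ^s)` ON EVERY TERMINAL WINDOW, every `s ∈ (1/2, 5/2)`**: along every maximal
smooth Leray–Hopf solution of the unforced system (`ν > 0`), for every `t₀ ∈ [0, T)`:
`∫⁻_{(t₀,T)} ‖u(τ)‖_{Ḣ^s}^{4/(2s−1)} dτ = ∞`. The Sobolev–Serrin scale (`2/q = s − 1/2`) thus diverges at every rung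
`1/2 < s < 5/2` — below `3/2` this is Prodi–Serrin read through `Ḣ^s ⊂ L^{6/(3−2s)}`, at `3/2` it is `∫‖u‖²_{Ḣ^{3/2}} = ∞`
(`L²_t Ḃ^{3/2}_{2,2}`, L56-S), above `3/2` the rungs `1 < q < 2` have no Lebesgue-space reading.
[cite: Prodi1959] [cite: RobinsonSadowskiSilva2012, (1.2), §IV] -/
theorem homSobolev_lintegral_eq_top (s : ℝ) (hs : s ∈ Ioo (1 / 2 : ℝ) (5 / 2)) {ν T : ℝ} (hν : 0 < ν)
    (hT : 0 < T) {u : ℝ → EuclideanSpace ℝ (Fin 3) → EuclideanSpace ℝ (Fin 3)}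
    {p : ℝ → EuclideanSpace ℝ (Fin 3) → ℝ}
    (hmax : IsMaximalSmoothSolution ν 0 u p T) (hLH : IsLerayHopfOn T ν 0 (u 0) u)
    {t₀ : ℝ} (ht₀ : t₀ ∈ Ico 0 T) :
    ∫⁻ τ in Ioo t₀ T,
      Function.eHomSobolevSeminorm s (⇑EuclideanSpace.complexify ∘ u τ) ^ (4 / (2 * s - 1)) = ∞ := by
  obtain ⟨c, hc, H⟩ := homSobolev_clock s hs
  have hb : 0 < (2 * s - 1) / 4 := by linarith [hs.1]
  have e1 : 1 / ((2 * s - 1) / 4) = 4 / (2 * s - 1) := by field_simp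
  have h := lintegral_rpow_eq_top_of_clock (a := (5 - 2 * s) / 4) hc hν hb ht₀.2
    (X := fun τ => Function.eHomSobolevSeminorm s (⇑EuclideanSpace.complexify ∘ u τ))
    (fun τ hτ => H ν T hν hT u p hmax hLH τ ⟨ht₀.1.trans_lt hτ.1, hτ.2⟩)
  rw [e1] at h
  exact h

/-! ## L58-P: the scale-free products with the energy -/

/-- **L58-P — THE SCALE-INVARIANT LADDER PRODUCTS ON THE WHOLE RANGE.** For every `s ∈ (1/2, 5/2)` there is
`c = c_s > 0` such that along every maximal smooth solution `(u, p)` of the unforced Navier–Stokes system on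
`ℝ³ × [0, T)` (`ν > 0`) which is Leray–Hopf from `u 0`, at EVERY `t ∈ (0, T)`:
`c · ν^{2s} ≤ ‖u(t)‖₂^{2s−1} · ‖u(t)‖_{Ḣ^s}` (`homSobolev_clock` × Leray's deadline `4c₂ν⁵(T − t) ≤ ‖u(t)‖₂⁴`; both sides
have the dimension of `ν^{2s}`). Extends L52-P (`s < 3/2`) and L56-P (`s = 3/2`, squared) up to `s < 5/2`.
[cite: Leray1934, §34 (6.4) p. 246] [cite: RobinsonSadowskiSilva2012, (1.2), §IV] -/
theorem homSobolev_energy_product (s : ℝ) (hs : s ∈ Ioo (1 / 2 : ℝ) (5 / 2)) :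
    ∃ c : ℝ, 0 < c ∧ ∀ (ν T : ℝ), 0 < ν → 0 < T →
      ∀ (u : ℝ → EuclideanSpace ℝ (Fin 3) → EuclideanSpace ℝ (Fin 3)) (p : ℝ → EuclideanSpace ℝ (Fin 3) → ℝ),
      IsMaximalSmoothSolution ν 0 u p T → IsLerayHopfOn T ν 0 (u 0) u →
      ∀ t ∈ Ioo 0 T,
        ENNReal.ofReal (c * ν ^ (2 * s)) ≤
          eLpNorm (u t) 2 volume ^ (2 * s - 1) * Function.eHomSobolevSeminorm s (⇑EuclideanSpace.complexify ∘ u t) := by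
  obtain ⟨c₁, hc₁, H₁⟩ := homSobolev_clock s hs
  obtain ⟨c₂, hc₂, H₂⟩ := LerayDeadline.deadline
  refine ⟨c₁ * (4 * c₂) ^ ((2 * s - 1) / 4), by positivity, fun ν T hν hT u p hmax hLH t ht => ?_⟩
  have hE : eLpNorm (u t) 2 volume = ENNReal.ofReal (eLpNorm (u t) 2 volume).toReal :=
    (ENNReal.ofReal_toReal (hLH.memLp t ⟨ht.1.le, ht.2.le⟩).eLpNorm_ne_top).symm
  rw [hE]
  exact product_of_clock_and_deadline hc₁ hc₂ hν hs.1 ht.2 ENNReal.toReal_nonneg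
    (H₂ ν T hν hT u p hmax hLH t ⟨ht.1.le, ht.2⟩) (H₁ ν T hν hT u p hmax hLH t ht)

/-! ## The interface reading -/

/-- **THE WHOLE LADDER READ ON THE INTERFACE: every cascade witness blows up in EVERY `Ḣ^s`, `1/2 < s < 5/2`, at the
optimal rate.** Every `W : CascadeWitness` yields `ν > 0`, `T > 0` and a maximal smooth solution `(u, p)` of the unforced
Navier–Stokes system on `ℝ³ × [0, T)`, Leray–Hopf from `u 0` (`x5a_of_cascadeWitness'`), such that for every
`s ∈ (1/2, 5/2)`, with the constant `c_s` of `homSobolev_clock`: `c_s ν^{(5−2s)/4} (T − t)^{−(2s−1)/4} ≤ ‖u(t)‖_{Ḣ^s}` at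
every `t ∈ (0, T)`, and `‖u(t)‖_{Ḣ^s} → ∞` as `t ↑ T`. Completes `HomSobolevLadder.homSobolev_clock_of_cascadeWitness`
(`s < 3/2`) and `HomSobolev32Clock.homSobolev32_clock_of_cascadeWitness` (`s = 3/2`). [cite: RobinsonSadowskiSilva2012, (1.2), §IV]
[cite: CheskidovZaya2016, Remark 2.3] -/
theorem homSobolev_clock_of_cascadeWitness (W : CascadeWitness) :
    ∃ ν : ℝ, 0 < ν ∧ ∃ T : ℝ, 0 < T ∧
      ∃ (u : ℝ → EuclideanSpace ℝ (Fin 3) → EuclideanSpace ℝ (Fin 3)) (p : ℝ → EuclideanSpace ℝ (Fin 3) → ℝ),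
        IsMaximalSmoothSolution ν 0 u p T ∧ IsLerayHopfOn T ν 0 (u 0) u ∧
        ∀ s : ℝ, ∀ hs : s ∈ Ioo (1 / 2 : ℝ) (5 / 2),
          (∀ t ∈ Ioo 0 T,
            ENNReal.ofReal ((homSobolev_clock s hs).choose * ν ^ ((5 - 2 * s) / 4) *
              (T - t) ^ (-((2 * s - 1) / 4))) ≤
              Function.eHomSobolevSeminorm s (⇑EuclideanSpace.complexify ∘ u t)) ∧
          Tendsto (fun t => Function.eHomSobolevSeminorm s (⇑EuclideanSpace.complexify ∘ u t)) (𝓝[<] T) (𝓝 ∞) := by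
  obtain ⟨ν, hν, T, hT, u, p, hmax, hLH, -⟩ := x5a_of_cascadeWitness' W
  refine ⟨ν, hν, T, hT, u, p, hmax, hLH, fun s hs => ⟨?_, homSobolev_tendsto_top s hs hν hT hmax hLH⟩⟩
  exact (homSobolev_clock s hs).choose_spec.2 ν T hν hT u p hmax hLH

end Summit.NavierStokesRegularity.FluidComputer.SobolevLadderRange

end
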